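import Summits.RiemannHypothesis.RiemannHypothesis.Theorems.RuelleBandAsymptoticToRealisation
import Summits.RiemannHypothesis.RiemannHypothesis.Theorems.RuelleBandRealisationToAsymptotic
import Summits.RiemannHypothesis.RiemannHypothesis.Theorems.RuelleBandBandEngineCore
import Summits.RiemannHypothesis.RiemannHypothesis.Theorems.AsymptoticCriticalLine.Negative.InteriorEdgeSplitStubs

/-!
# `AsymptoticCriticalLine` (crux stmt-RiemannHypothesis-2063): the interior stub is Faure–Tsujii
# approximate unitarity WINDOW BY WINDOW

Support file of the line `interior-edge-split` (lead prover-line-stmt-RiemannHypothesis-2063-c1-0),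
periphery (not in the composition). CALIBRATION of the line's stub 1 (`stub_noRightInteriorBand`:
"no right-interior band" — every `σ₀ ∈ (1/2, 1)` has a vertical neighbourhood `|Re s − σ₀| < ε`
holding only finitely many zeros of `ζ`) in the route's own operator language:

* `noRightInteriorBand_iff_windowedBandRealisation` (registered periphery stub):
  stub 1 ⟺ for EVERY weight window `a ∈ (0, 1/2)` there is a `BandRealisation` of the zeros of `ζ`
  with `a < Re s < 1 − a` — a one-parameter GROUP `T` of bounded operators on a complex Hilbert
  space, unitary modulo a compact operator at some `t₀ > 0`, with every such zero a joint eigenvalue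
  of character `t ↦ e^{t(s − 1/2)}`. So the INTERIOR stub is exactly the route's typed crux
  `BandRealisation` (⟺ the crux `AsymptoticCriticalLine`, items 2066/2067) imposed window by window,
  and the EDGE stub (route Strip's crux) is precisely the difference between "every window" and "the
  whole strip".
  - ⟸ (`noRightInteriorBand_of_windowedBandRealisation`) is the landed `BandEngine`
    (`finite_jointEigenvalues_abs_re_ge`): around `σ₀` use the window `a = (1 − σ₀)/2`.
  - ⟹ (`windowedBandRealisation_of_noRightInteriorBand`) is the diagonal group on `ℓ²` over the
    zeros of the window (`exists_diagonalBandGroup`): its symbol tends to the unit circle cofinitely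
    BECAUSE stub 1 and the reflection `s ↦ 1 − s` make every closed slab of the window off the line
    finite (`window_offLine_finite_of_noRightInteriorBand`, via `Negative.noRightInteriorBand_iff_Icc`).
* `windowedRealisation_of_noRightInteriorBand` (registered periphery stub): stub 1 ⟹ the hypothesis
  of lead -0's `noRightInteriorBand_of_windowedRealisation` (the windowed THREE-CIRCLE typing,
  `RuelleBandAsymptoticCriticalLineWindowedEngine.lean`), so that typing is calibrated too: as an
  `∃`-statement it is circular, exactly as its docstring says. The passage from "unitary + compact"
  to the three-circle data (`threeCircleData_of_unitary_add_compact`) uses `σ(U) ⊆` unit circle and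
  the tree's analytic Fredholm alternative `spectrum_add_compact_isolated_eigenvalues` on the
  exterior of the unit disc (non-degenerate at `‖μ‖ > ‖T t₀‖`) to find a resolvent point of `T t₀`
  inside the annulus `1 < ‖μ‖ < e^{(1/2 − a)t₀}`.

Honesty: none of this is progress on `ζ`; it says what a PINNED windowed construction over
`Literature.NumberTheory.Automorphic.Meyer.ideleClassSchwartzWeighted ℚ (a, 1 − a)` must deliver and
that nothing weaker than stub 1 can come out of it.
-/

noncomputable section

namespace Summit.RiemannHypothesis.RiemannHypothesis.Theorems

open Complex Filter Topology Set Metric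
open scoped lp
open Literature.Analysis.OperatorTheory (spectrum_add_compact_isolated_eigenvalues)

/-! ## 1. Under stub 1 the zeros of a weight window approach the line cofinitely -/

/-- Under stub 1 ("no right-interior band"), for every weight window `a > 0` and every `ε > 0` only
finitely many zeros of `ζ` with `a < Re s < 1 − a` lie at distance `≥ ε` from the critical line:
the right slab `1/2 + ε ≤ Re s ≤ 1 − a` is finite by the compact-interval form of stub 1
(`Negative.noRightInteriorBand_iff_Icc`), and the left slab reflects into it under `s ↦ 1 − s`
(`GeneralizedRH.riemannZeta_one_sub_eq_zero`). [folklore] -/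
theorem window_offLine_finite_of_noRightInteriorBand
    (h1 : ∀ σ₀ : ℝ, 1 / 2 < σ₀ → σ₀ < 1 →
      ∃ ε : ℝ, 0 < ε ∧ {s : ℂ | riemannZeta s = 0 ∧ 0 < s.re ∧ s.re < 1 ∧ |s.re - σ₀| < ε}.Finite)
    {a : ℝ} (ha : 0 < a) {ε : ℝ} (hε : 0 < ε) :
    {s : ℂ | riemannZeta s = 0 ∧ a < s.re ∧ s.re < 1 - a ∧ ε ≤ |s.re - 1 / 2|}.Finite := by
  have hR : {s : ℂ | riemannZeta s = 0 ∧ 1 / 2 + ε ≤ s.re ∧ s.re ≤ 1 - a}.Finite :=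
    AsymptoticCriticalLine.Negative.noRightInteriorBand_iff_Icc.1 h1 (1 / 2 + ε) (1 - a)
      (by linarith) (by linarith)
  refine (hR.union (hR.image fun s : ℂ => 1 - s)).subset ?_
  rintro s ⟨hz, has, hsa, hεs⟩
  rcases le_abs'.1 hεs with h | h
  · -- left slab: `1 - s` lies in the right slab
    refine Or.inr ⟨1 - s, ⟨?_, ?_, ?_⟩, sub_sub_cancel 1 s⟩
    · exact Literature.NumberTheory.LFunctions.GeneralizedRH.riemannZeta_one_sub_eq_zero hz
        (by linarith) (by linarith)
    · simp only [Complex.sub_re, Complex.one_re]; linarith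
    · simp only [Complex.sub_re, Complex.one_re]; linarith
  · exact Or.inl ⟨hz, by linarith, hsa.le⟩

/-! ## 2. Stub 1 ⟹ a band realisation on every weight window (the diagonal group) -/

/-- **Stub 1 ⟹ windowed `BandRealisation`.** Under "no right-interior band", for every weight window
`a ∈ (0, 1/2)` the diagonal group `T t = diag(e^{t(ρ − 1/2)})` on `ℓ²` over the zeros `ρ` of `ζ` with
`a < Re ρ < 1 − a` (`exists_diagonalBandGroup`) is a one-parameter group, unitary modulo a compact
operator at time `1` (the symbol tends to the unit circle cofinitely by
`window_offLine_finite_of_noRightInteriorBand`), and carries each such zero as a joint eigenvalue.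
The honesty half of the calibration: the windowed typing is circular as an `∃`-statement. [folklore] -/
theorem windowedBandRealisation_of_noRightInteriorBand
    (h1 : ∀ σ₀ : ℝ, 1 / 2 < σ₀ → σ₀ < 1 →
      ∃ ε : ℝ, 0 < ε ∧ {s : ℂ | riemannZeta s = 0 ∧ 0 < s.re ∧ s.re < 1 ∧ |s.re - σ₀| < ε}.Finite) :
    ∀ a : ℝ, 0 < a → a < 1 / 2 →
      ∃ (H : Type) (_ : NormedAddCommGroup H) (_ : InnerProductSpace ℂ H) (_ : CompleteSpace H)
        (T : ℝ → H →L[ℂ] H), T 0 = ContinuousLinearMap.id ℂ H ∧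
        (∀ s t : ℝ, T (s + t) = (T s).comp (T t)) ∧
        (∃ t₀ : ℝ, 0 < t₀ ∧ ∃ U : H →L[ℂ] H, U ∈ unitary (H →L[ℂ] H) ∧
          IsCompactOperator (T t₀ - U)) ∧
        (∀ s : ℂ, riemannZeta s = 0 → a < s.re → s.re < 1 - a →
          ∃ v : H, v ≠ 0 ∧ ∀ t : ℝ, T t v = Complex.exp (↑t * (s - 1 / 2)) • v) := by
  intro a ha _
  set ι := {s : ℂ // riemannZeta s = 0 ∧ a < s.re ∧ s.re < 1 - a}
  have hρ : ∀ i : ι, 0 < (i : ℂ).re ∧ (i : ℂ).re < 1 := fun i =>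
    ⟨ha.trans i.2.2.1, by linarith [i.2.2.2]⟩
  have hlim : ∀ ε : ℝ, 0 < ε → {i : ι | ε ≤ |(i : ℂ).re - 1 / 2|}.Finite := by
    intro ε hε
    refine ((window_offLine_finite_of_noRightInteriorBand h1 ha hε).preimage
      Set.injOn_subtype_val).subset ?_
    intro i hi
    exact ⟨i.2.1, i.2.2.1, i.2.2.2, hi⟩
  obtain ⟨T, h0, hadd, hcpt, heig⟩ := exists_diagonalBandGroup (ι := ι) (fun i => (i : ℂ)) hρ hlim
  exact ⟨ℓ²(ι, ℂ), inferInstance, inferInstance, inferInstance, T, h0, hadd, hcpt,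
    fun s hs has hsa => heig ⟨s, hs, has, hsa⟩⟩

/-! ## 3. Windowed band realisation ⟹ stub 1 (the landed `BandEngine`) -/

/-- **Windowed `BandRealisation` ⟹ stub 1.** If for every weight window `a ∈ (0, 1/2)` the zeros of
`ζ` with `a < Re s < 1 − a` are joint eigenvalues `e^{t(s − 1/2)}` of a one-parameter group on a
complex Hilbert space that is unitary modulo a compact operator at some `t₀ > 0`, then the real parts
of the zeros do not accumulate at any `σ₀ ∈ (1/2, 1)`: around `σ₀` take the window
`a = (1 − σ₀)/2` and the radius `ε = min ((σ₀ − 1/2)/2) ((1 − σ₀)/4)`; the neighbourhood injects by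
`s ↦ s − 1/2` into the finite set of joint eigenvalues `z` with `(σ₀ − 1/2)/2 ≤ |Re z|` of the band
engine (`finite_jointEigenvalues_abs_re_ge` = the route's `BandEngine`). [folklore] -/
theorem noRightInteriorBand_of_windowedBandRealisation
    (hW : ∀ a : ℝ, 0 < a → a < 1 / 2 →
      ∃ (H : Type) (_ : NormedAddCommGroup H) (_ : InnerProductSpace ℂ H) (_ : CompleteSpace H)
        (T : ℝ → H →L[ℂ] H), T 0 = ContinuousLinearMap.id ℂ H ∧
        (∀ s t : ℝ, T (s + t) = (T s).comp (T t)) ∧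
        (∃ t₀ : ℝ, 0 < t₀ ∧ ∃ U : H →L[ℂ] H, U ∈ unitary (H →L[ℂ] H) ∧
          IsCompactOperator (T t₀ - U)) ∧
        (∀ s : ℂ, riemannZeta s = 0 → a < s.re → s.re < 1 - a →
          ∃ v : H, v ≠ 0 ∧ ∀ t : ℝ, T t v = Complex.exp (↑t * (s - 1 / 2)) • v)) :
    ∀ σ₀ : ℝ, 1 / 2 < σ₀ → σ₀ < 1 →
      ∃ ε : ℝ, 0 < ε ∧ {s : ℂ | riemannZeta s = 0 ∧ 0 < s.re ∧ s.re < 1 ∧ |s.re - σ₀| < ε}.Finite := by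
  intro σ₀ hσ₀ hσ₁
  obtain ⟨H, _, _, _, T, hT0, hTadd, ⟨t₀, ht₀, U, hU, hK⟩, heig⟩ :=
    hW ((1 - σ₀) / 2) (by linarith) (by linarith)
  set ε : ℝ := min ((σ₀ - 1 / 2) / 2) ((1 - σ₀) / 4) with hε
  have hε0 : 0 < ε := lt_min (by linarith) (by linarith)
  have hε1 : ε ≤ (σ₀ - 1 / 2) / 2 := min_le_left _ _
  have hε2 : ε ≤ (1 - σ₀) / 4 := min_le_right _ _
  refine ⟨ε, hε0, ?_⟩
  have hfin := finite_jointEigenvalues_abs_re_ge T hT0 hTadd ht₀ hU hK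
    (ε := (σ₀ - 1 / 2) / 2) (by linarith)
  refine Set.Finite.subset (hfin.preimage (sub_left_injective (b := (1 / 2 : ℂ))).injOn) ?_
  rintro s ⟨hz, -, -, hs⟩
  rw [abs_sub_lt_iff] at hs
  obtain ⟨v, hv0, hv⟩ := heig s hz (by linarith) (by linarith)
  refine ⟨?_, v, hv0, fun t => hv t⟩
  have hre : (s - 1 / 2 : ℂ).re = s.re - 1 / 2 := by simp
  show (σ₀ - 1 / 2) / 2 ≤ |(s - 1 / 2 : ℂ).re|
  rw [hre, abs_of_pos (by linarith)]
  linarith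

/-- **CALIBRATION (registered periphery stub `noRightInteriorBand_iff_windowedBandRealisation` of
crux stmt-RiemannHypothesis-2063, line `interior-edge-split`).** The interior stub
`stub_noRightInteriorBand` holds iff EVERY weight window `a < Re s < 1 − a` (`0 < a < 1/2`) carries a
`BandRealisation` of its zeros: a one-parameter group on a complex Hilbert space, unitary modulo a
compact operator at some `t₀ > 0`, with every zero of the window a joint eigenvalue `e^{t(s − 1/2)}`.
Reading: the interior stub IS Faure–Tsujii approximate unitarity window by window, as the crux is
approximate unitarity on the whole strip (`BandRealisation ⟺ AsymptoticCriticalLine`, items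
2066/2067); the edge stub is the difference. As an `∃`-statement the right-hand side is circular
(⟹ is the diagonal group); its role is to type what a PINNED windowed construction must deliver.
[folklore] -/
theorem noRightInteriorBand_iff_windowedBandRealisation :
    (∀ σ₀ : ℝ, 1 / 2 < σ₀ → σ₀ < 1 →
      ∃ ε : ℝ, 0 < ε ∧ {s : ℂ | riemannZeta s = 0 ∧ 0 < s.re ∧ s.re < 1 ∧ |s.re - σ₀| < ε}.Finite) ↔
    ∀ a : ℝ, 0 < a → a < 1 / 2 →
      ∃ (H : Type) (_ : NormedAddCommGroup H) (_ : InnerProductSpace ℂ H) (_ : CompleteSpace H)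
        (T : ℝ → H →L[ℂ] H), T 0 = ContinuousLinearMap.id ℂ H ∧
        (∀ s t : ℝ, T (s + t) = (T s).comp (T t)) ∧
        (∃ t₀ : ℝ, 0 < t₀ ∧ ∃ U : H →L[ℂ] H, U ∈ unitary (H →L[ℂ] H) ∧
          IsCompactOperator (T t₀ - U)) ∧
        (∀ s : ℂ, riemannZeta s = 0 → a < s.re → s.re < 1 - a →
          ∃ v : H, v ≠ 0 ∧ ∀ t : ℝ, T t v = Complex.exp (↑t * (s - 1 / 2)) • v) :=
  ⟨windowedBandRealisation_of_noRightInteriorBand, noRightInteriorBand_of_windowedBandRealisation⟩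

/-! ## 4. From "unitary + compact" to the three-circle data -/

section ThreeCircle

variable {H : Type} [NormedAddCommGroup H] [InnerProductSpace ℂ H] [CompleteSpace H]

/-- Off the unit circle every point is a resolvent point of a unitary operator on a Hilbert space
(`σ(U) ⊆` unit circle, Mathlib `spectrum.norm_eq_one_of_unitary`). [folklore] -/
theorem mem_resolventSet_of_unitary_of_norm_ne_one {U : H →L[ℂ] H} (hU : U ∈ unitary (H →L[ℂ] H))
    {μ : ℂ} (hμ : ‖μ‖ ≠ 1) : μ ∈ resolventSet ℂ U := by
  rw [spectrum.mem_resolventSet_iff]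
  by_contra h
  exact hμ (spectrum.norm_eq_one_of_unitary hU (spectrum.mem_iff.2 h))

/-- A point of modulus `> ‖A‖ · ‖1‖` is a resolvent point of `A` (Neumann series; Mathlib
`spectrum.mem_resolventSet_of_norm_lt_mul`, stated so that no `NormOneClass` — i.e. no
nontriviality of `H` — is needed). [folklore] -/
theorem mem_resolventSet_of_norm_gt (A : H →L[ℂ] H) {μ : ℂ} (hμ : ‖A‖ + 1 ≤ ‖μ‖) :
    μ ∈ resolventSet ℂ A := by
  refine spectrum.mem_resolventSet_of_norm_lt_mul ?_
  have h1 : ‖(1 : H →L[ℂ] H)‖ ≤ 1 := ContinuousLinearMap.norm_id_le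
  have hA : 0 ≤ ‖A‖ := norm_nonneg _
  calc ‖A‖ * ‖(1 : H →L[ℂ] H)‖ ≤ ‖A‖ * 1 := mul_le_mul_of_nonneg_left h1 hA
    _ < ‖μ‖ := by linarith

/-- **Unitary + compact ⟹ three-circle data.** If `A = U + K` on a complex Hilbert space with `U`
unitary and `K` compact, then for every `R > 1`: the open annulus `1 < ‖μ‖ < R` lies in `ρ(U)`, and
it contains a resolvent point of `A`. The second clause is the analytic Fredholm alternative on the
exterior `{‖μ‖ > 1} ⊆ ρ(U)` of the unit disc (`spectrum_add_compact_isolated_eigenvalues`,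
non-degenerate at any `‖μ₀‖ ≥ ‖A‖ + 1`): the spectrum of `A` there is discrete, so a punctured
neighbourhood of any point of the annulus meets the resolvent set inside the annulus. [folklore] -/
theorem threeCircleData_of_unitary_add_compact (A U K : H →L[ℂ] H)
    (hU : U ∈ unitary (H →L[ℂ] H)) (hK : IsCompactOperator K) (hA : A = U + K) {R : ℝ} (hR : 1 < R) :
    ({μ : ℂ | 1 < ‖μ‖ ∧ ‖μ‖ < R} ⊆ resolventSet ℂ U) ∧
      ∃ μ₀ : ℂ, (1 < ‖μ₀‖ ∧ ‖μ₀‖ < R) ∧ μ₀ ∈ resolventSet ℂ A := by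
  have hann : {μ : ℂ | 1 < ‖μ‖ ∧ ‖μ‖ < R} ⊆ resolventSet ℂ U := fun μ hμ =>
    mem_resolventSet_of_unitary_of_norm_ne_one hU (ne_of_gt hμ.1)
  refine ⟨hann, ?_⟩
  -- the exterior of the unit disc
  set D : Set ℂ := {μ : ℂ | 1 < ‖μ‖} with hDdef
  have hD : IsOpen D := isOpen_lt continuous_const continuous_norm
  have hDc : IsConnected D := by
    have := RuelleBand.isConnected_exterior 0
    simpa [Real.exp_zero, hDdef] using this
  have hDS : D ⊆ resolventSet ℂ U := fun μ hμ =>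
    mem_resolventSet_of_unitary_of_norm_ne_one hU (ne_of_gt hμ)
  -- a far-away resolvent point of `A`
  set z₀ : ℂ := ((‖A‖ + 2 : ℝ) : ℂ) with hz₀def
  have hz₀n : ‖z₀‖ = ‖A‖ + 2 := by
    rw [hz₀def, Complex.norm_real, Real.norm_eq_abs, abs_of_pos (by positivity)]
  have hz₀D : z₀ ∈ D := by
    show 1 < ‖z₀‖
    rw [hz₀n]; linarith [norm_nonneg A]
  have hz₀ρ : z₀ ∈ resolventSet ℂ (U + K) := by
    rw [← hA]
    exact mem_resolventSet_of_norm_gt A (by rw [hz₀n]; linarith)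
  obtain ⟨hiso, -⟩ := spectrum_add_compact_isolated_eigenvalues U K hK hD hDc hDS hz₀D hz₀ρ
  -- a point of the annulus and a punctured neighbourhood of it
  set z₁ : ℂ := (((1 + R) / 2 : ℝ) : ℂ) with hz₁def
  have hz₁n : ‖z₁‖ = (1 + R) / 2 := by
    rw [hz₁def, Complex.norm_real, Real.norm_eq_abs, abs_of_pos (by linarith)]
  have hz₁ann : 1 < ‖z₁‖ ∧ ‖z₁‖ < R := by rw [hz₁n]; constructor <;> linarith
  have hopen : IsOpen {μ : ℂ | 1 < ‖μ‖ ∧ ‖μ‖ < R} :=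
    (isOpen_lt continuous_const continuous_norm).inter (isOpen_lt continuous_norm continuous_const)
  have hev1 : ∀ᶠ w in 𝓝[≠] z₁, w ∈ resolventSet ℂ (U + K) := hiso z₁ hz₁ann.1
  have hev2 : ∀ᶠ w in 𝓝[≠] z₁, w ∈ {μ : ℂ | 1 < ‖μ‖ ∧ ‖μ‖ < R} :=
    eventually_nhdsWithin_of_eventually_nhds (hopen.mem_nhds hz₁ann)
  obtain ⟨w, hwρ, hwann⟩ := (hev1.and hev2).exists
  exact ⟨w, hwann, by rw [hA]; exact hwρ⟩

end ThreeCircle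

/-- **Stub 1 ⟹ the windowed three-circle hypothesis (registered periphery stub
`windowedRealisation_of_noRightInteriorBand`; converse of lead -0's
`noRightInteriorBand_of_windowedRealisation`, `RuelleBandAsymptoticCriticalLineWindowedEngine.lean`).**
Under "no right-interior band", every weight window `a ∈ (0, 1/2)` admits the three-circle data: an
`ℝ`-indexed family `T` on a complex Hilbert space, `t₀ > 0`, `T t₀ = S + K` with `K` compact, the open
annulus `1 < ‖μ‖ < e^{(1/2 − a)t₀}` inside `ρ(S)` and containing a resolvent point of `T t₀`, and every
zero of `ζ` in the window a joint eigenvalue `e^{t(s − 1/2)}`. Witness: the diagonal group of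
`windowedBandRealisation_of_noRightInteriorBand` with `S := U` unitary, `K := T t₀ − U`
(`threeCircleData_of_unitary_add_compact`). So the three-circle typing, like the windowed
`BandRealisation` typing, is EQUIVALENT to stub 1 — calibrated, circular as an `∃`-statement.
[folklore] -/
theorem windowedRealisation_of_noRightInteriorBand :
    (∀ σ₀ : ℝ, 1 / 2 < σ₀ → σ₀ < 1 →
      ∃ ε : ℝ, 0 < ε ∧ {s : ℂ | riemannZeta s = 0 ∧ 0 < s.re ∧ s.re < 1 ∧ |s.re - σ₀| < ε}.Finite) →
    ∀ a : ℝ, 0 < a → a < 1 / 2 →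
      ∃ (H : Type) (_ : NormedAddCommGroup H) (_ : InnerProductSpace ℂ H) (_ : CompleteSpace H)
        (T : ℝ → H →L[ℂ] H) (t₀ : ℝ) (S K : H →L[ℂ] H),
        0 < t₀ ∧ IsCompactOperator K ∧ T t₀ = S + K ∧
        ({μ : ℂ | 1 < ‖μ‖ ∧ ‖μ‖ < Real.exp ((1 / 2 - a) * t₀)} ⊆ resolventSet ℂ S) ∧
        (∃ μ₀ : ℂ, (1 < ‖μ₀‖ ∧ ‖μ₀‖ < Real.exp ((1 / 2 - a) * t₀)) ∧ μ₀ ∈ resolventSet ℂ (T t₀)) ∧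
        (∀ s : ℂ, riemannZeta s = 0 → a < s.re → s.re < 1 - a →
          ∃ v : H, v ≠ 0 ∧ ∀ t : ℝ, T t v = Complex.exp (↑t * (s - 1 / 2)) • v) := by
  intro h1 a ha ha2
  obtain ⟨H, _, _, _, T, -, -, ⟨t₀, ht₀, U, hU, hK⟩, heig⟩ :=
    windowedBandRealisation_of_noRightInteriorBand h1 a ha ha2
  have hA : T t₀ = U + (T t₀ - U) := by abel
  have hR : 1 < Real.exp ((1 / 2 - a) * t₀) := Real.one_lt_exp_iff.2 (by nlinarith)
  obtain ⟨hann, μ₀, hμ₀, hμ₀ρ⟩ := threeCircleData_of_unitary_add_compact (T t₀) U (T t₀ - U) hU hK hA hR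
  exact ⟨H, inferInstance, inferInstance, inferInstance, T, t₀, U, T t₀ - U, ht₀, hK, hA, hann,
    ⟨μ₀, hμ₀, hμ₀ρ⟩, heig⟩

end Summit.RiemannHypothesis.RiemannHypothesis.Theorems

end
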